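import Summits.Ventures.PercRepro.ProfilePointedCircuitClassesTwelveCocircuitC

/-!
# PercRepro — THE COCIRCUIT REGIME, PART D: THE SINGLY CAPTURED DEMANDS, THE CAPTURE INEQUALITY (C), AND THE
TWELVE-POINT STATEMENT AT A POINT OF A 3-COCIRCUIT THROUGH A SERIES PAIR (p5, gen 48; `proofs/P5-GM1.md` §71)

The singly captured demands (`a' ∈ cl W`, `p ∉ cl W`) inject into the units containing `a, a'` by
`W ↦ W − e + a' + p`; with parts A–C the capture inequality (C) of TwelveCaptureB holds in the cocircuit regime,
and the capture reduction gives `in_5(e) ≤ out_6(e)` — THE TWELVE-POINT STATEMENT AT EVERY POINT `e` OF A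
3-COCIRCUIT `{a', e, p}` WHOSE THIRD POINT `a'` HAS A SERIES TWIN `a` (`e` off the line of the pair; on the line,
TwelveCaptureD).  In the dual `M = N✶` this is a point `e` on a 4-point line `{a, a', e, p}` through the parallel
pair `{a, a'}` — the «pair + two points» shape of a co-rank-2 quadruple (§65(e)(2)), previously settled only
under the global quad2 hypothesis (§65(i)) — and it is exactly the cocircuit subcase of §68(d)(ii), the one
configuration where the §59-type charging of (C) had target-less demands.
-/

open scoped Matroid

namespace PercRepro.Cogirth

open Finset ThmH Skew Shadow Profile

variable {α : Type} [DecidableEq α] {N : Matroid α} [N.Finite]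

section TwelveCocircuitD

/-- **A SINGLY CAPTURED DEMAND INJECTS INTO THE UNITS CONTAINING `a, a'`**: for `W ∈ BI_5` with `e, a ∈ W`,
`a' ∈ cl W`, `p ∉ cl W`, the set `S = W − e + a' + p` is a bi-independent 6-set: `W − e + p` is independent
(`p ∉ cl` of a subset of `H`), `a' ∉ cl(W − e + p)` (else, with `a' ∈ cl W`, both `e` and `p` would lie in
`cl(W − e + a')`, of rank `5`, against `ρ(W + p) = 6`), and `E ∖ S = (E ∖ S − e) + e` is independent
(`E ∖ S − e ⊆ E ∖ W ∩ H`). -/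
theorem card_filter_singly_captured_le_card_filter_both (hn : (gr N).card = 12) (hR : rk N (gr N) = 7)
    {a a' e p : α} (h : SeriesPair N a a') (he : e ∈ gr N) (hp : p ∈ gr N) (hea : e ≠ a) (hea' : e ≠ a')
    (hpa : p ≠ a) (hpa' : p ≠ a') (hep : e ≠ p) (hcoc : rk N ((((gr N).erase a').erase e).erase p) = 6)
    (hH : ∀ X ⊆ (((gr N).erase a').erase e).erase p,
      rk N (insert a' X) = rk N X + 1 ∧ rk N (insert e X) = rk N X + 1 ∧ rk N (insert p X) = rk N X + 1) :
    ((biIndepSets N 5).filter (fun W => ((e ∈ W ∧ a ∈ W) ∧ rk N (insert a' W) = 5) ∧ ¬ rk N (insert p W) = 5)).card ≤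
    ((biIndepSets N 6).filter (fun S => (e ∉ S ∧ a ∈ S) ∧ a' ∈ S)).card := by
  have ha : a ∈ gr N := h.1
  have ha' : a' ∈ gr N := h.2.1
  have hne : a ≠ a' := h.2.2.1
  apply card_le_card_of_injOn (fun W => insert a' (insert p (W.erase e)))
  · intro W hW
    rw [mem_coe, mem_filter] at hW
    obtain ⟨hWb, ⟨⟨heW, haW⟩, hWa'⟩, hWp⟩ := hW
    obtain ⟨hWg, hWc, hWr, hWcompl⟩ := mem_biIndepSets.1 hWb
    obtain ⟨ha'W, hpW⟩ := not_mem_of_mem_biIndepSets_five_cocircuit hn hR h hea hpa hcoc hWb heW haW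
    have hWr5 : rk N W = 5 := by rw [hWr, hWc]
    have hWp6 : rk N (insert p W) = 6 := by
      have h1 := rk_insert_le_add_one hp hWg
      have h2 := rk_mono' (M := N) (subset_insert p W)
      omega
    -- `K := W − e ⊆ H`
    have hKH : W.erase e ⊆ (((gr N).erase a').erase e).erase p := by
      intro x hx
      rw [mem_erase] at hx
      exact mem_erase.2 ⟨fun h' => hpW (h' ▸ hx.2), mem_erase.2 ⟨hx.1, mem_erase.2 ⟨fun h' => ha'W (h' ▸ hx.2), hWg hx.2⟩⟩⟩
    have hKg : W.erase e ⊆ gr N := (erase_subset _ _).trans hWg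
    have hKc : (W.erase e).card = 4 := by rw [card_erase_of_mem heW, hWc]
    have hKr : rk N (W.erase e) = 4 := by
      rw [← hKc]
      exact rk_eq_card_of_subset_of_rk_eq_card (erase_subset _ _) hWr
    have hpK : p ∉ W.erase e := fun h' => hpW (mem_of_mem_erase h')
    have ha'K : a' ∉ insert p (W.erase e) := by
      rw [mem_insert, not_or]
      exact ⟨hpa'.symm, fun h' => ha'W (mem_of_mem_erase h')⟩
    have hpKr : rk N (insert p (W.erase e)) = 5 := by rw [(hH _ hKH).2.2, hKr]
    have hSc : (insert a' (insert p (W.erase e))).card = 6 := by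
      rw [card_insert_of_notMem ha'K, card_insert_of_notMem hpK, hKc]
    -- `ρ(S) = 6`
    have hSr : rk N (insert a' (insert p (W.erase e))) = 6 := by
      have h1 := rk_insert_le_add_one ha' (insert_subset hp hKg)
      have h2 := rk_mono' (M := N) (subset_insert a' (insert p (W.erase e)))
      by_contra hne6
      have h5 : rk N (insert a' (insert p (W.erase e))) = 5 := by omega
      -- `K' := K + a'` has rank `5` and captures both `p` and `e`
      have hK'r : rk N (insert a' (W.erase e)) = 5 := by rw [(hH _ hKH).1, hKr]
      have hK'g : insert a' (W.erase e) ⊆ gr N := insert_subset ha' hKg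
      have hpcl : p ∈ clF N (insert a' (W.erase e)) := by
        rw [mem_clF_iff_rk_insert_eq hp hK'g, insert_comm, h5, hK'r]
      have hecl : e ∈ clF N (insert a' (W.erase e)) := by
        rw [mem_clF_iff_rk_insert_eq he hK'g, insert_comm, insert_erase heW, hWa', hK'r]
      have hcl : ({e, p} : Finset α) ⊆ clF N (insert a' (W.erase e)) :=
        insert_subset hecl (singleton_subset_iff.2 hpcl)
      have h3 := rk_union_eq_of_subset_clF hK'g hcl
      have hsub : insert p W ⊆ insert a' (W.erase e) ∪ {e, p} := by
        intro x hx
        rw [mem_insert] at hx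
        rcases hx with rfl | hx
        · exact mem_union_right _ (mem_insert_of_mem (mem_singleton_self _))
        · by_cases hxe : x = e
          · exact mem_union_right _ (mem_insert.2 (Or.inl hxe))
          · exact mem_union_left _ (mem_insert_of_mem (mem_erase.2 ⟨hxe, hx⟩))
      have h4 := rk_mono' (M := N) hsub
      omega
    -- the complement
    have heS : e ∉ insert a' (insert p (W.erase e)) := by
      rw [mem_insert, mem_insert, not_or, not_or]
      exact ⟨hea', hep, fun h' => (mem_erase.1 h').1 rfl⟩
    have hSg : insert a' (insert p (W.erase e)) ⊆ gr N := insert_subset ha' (insert_subset hp hKg)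
    have hcc : (gr N \ insert a' (insert p (W.erase e))).card = 6 := by
      rw [card_sdiff_of_subset hSg, hn, hSc]
    have heC : e ∈ gr N \ insert a' (insert p (W.erase e)) := mem_sdiff.2 ⟨he, heS⟩
    have hZH : (gr N \ insert a' (insert p (W.erase e))).erase e ⊆ (((gr N).erase a').erase e).erase p := by
      intro x hx
      rw [mem_erase, mem_sdiff, mem_insert, mem_insert, not_or, not_or] at hx
      exact mem_erase.2 ⟨hx.2.2.2.1, mem_erase.2 ⟨hx.1, mem_erase.2 ⟨hx.2.2.1, hx.2.1⟩⟩⟩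
    have hZW : (gr N \ insert a' (insert p (W.erase e))).erase e ⊆ gr N \ W := by
      intro x hx
      rw [mem_erase, mem_sdiff, mem_insert, mem_insert, not_or, not_or] at hx
      rw [mem_sdiff]
      exact ⟨hx.2.1, fun hxW => hx.2.2.2.2 (mem_erase.2 ⟨hx.1, hxW⟩)⟩
    have hZc : ((gr N \ insert a' (insert p (W.erase e))).erase e).card = 5 := by
      rw [card_erase_of_mem heC, hcc]
    have hZr : rk N ((gr N \ insert a' (insert p (W.erase e))).erase e) = 5 := by
      rw [← hZc]
      exact rk_eq_card_of_subset_of_rk_eq_card hZW hWcompl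
    have hcompl_r : rk N (gr N \ insert a' (insert p (W.erase e))) = 6 := by
      rw [← insert_erase heC, (hH _ hZH).2.1, hZr]
    rw [mem_coe, mem_filter, mem_biIndepSets]
    refine ⟨⟨hSg, hSc, by rw [hSr, hSc], by rw [hcompl_r, hcc]⟩, ⟨heS, ?_⟩, mem_insert_self _ _⟩
    exact mem_insert_of_mem (mem_insert_of_mem (mem_erase.2 ⟨hea.symm, haW⟩))
  · intro W₁ hW₁ W₂ hW₂ heq
    rw [mem_coe, mem_filter] at hW₁ hW₂
    obtain ⟨ha'₁, hp₁⟩ := not_mem_of_mem_biIndepSets_five_cocircuit hn hR h hea hpa hcoc hW₁.1 hW₁.2.1.1.1 hW₁.2.1.1.2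
    obtain ⟨ha'₂, hp₂⟩ := not_mem_of_mem_biIndepSets_five_cocircuit hn hR h hea hpa hcoc hW₂.1 hW₂.2.1.1.1 hW₂.2.1.1.2
    have hpK₁ : p ∉ W₁.erase e := fun h' => hp₁ (mem_of_mem_erase h')
    have hpK₂ : p ∉ W₂.erase e := fun h' => hp₂ (mem_of_mem_erase h')
    have ha'K₁ : a' ∉ insert p (W₁.erase e) := by
      rw [mem_insert, not_or]; exact ⟨hpa'.symm, fun h' => ha'₁ (mem_of_mem_erase h')⟩
    have ha'K₂ : a' ∉ insert p (W₂.erase e) := by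
      rw [mem_insert, not_or]; exact ⟨hpa'.symm, fun h' => ha'₂ (mem_of_mem_erase h')⟩
    have heq' : insert a' (insert p (W₁.erase e)) = insert a' (insert p (W₂.erase e)) := heq
    rw [← insert_erase hW₁.2.1.1.1, ← insert_erase hW₂.2.1.1.1, ← erase_insert hpK₁, ← erase_insert hpK₂,
      ← erase_insert ha'K₁, ← erase_insert ha'K₂, heq']

/-- **THE CAPTURE INEQUALITY (C) IN THE COCIRCUIT REGIME**: the captured demands through `a` are at most the
capturing units through `a` — the doubly captured ones through the `Q`-tight 3-sets, the local LYM and the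
`Q`-tight 4-sets, the singly captured ones by `W ↦ W − e + a' + p`. -/
theorem captureIneq_of_cocircuit (hn : (gr N).card = 12) (hR : rk N (gr N) = 7) {a a' e p : α}
    (h : SeriesPair N a a') (he : e ∈ gr N) (hp : p ∈ gr N) (hea : e ≠ a) (hea' : e ≠ a') (hpa : p ≠ a)
    (hpa' : p ≠ a') (hep : e ≠ p) (hcoc : rk N ((((gr N).erase a').erase e).erase p) = 6)
    (hH : ∀ X ⊆ (((gr N).erase a').erase e).erase p,
      rk N (insert a' X) = rk N X + 1 ∧ rk N (insert e X) = rk N X + 1 ∧ rk N (insert p X) = rk N X + 1)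
    (hQ : rk N {a, a', e} = 3) :
    ((biIndepSets N 5).filter (fun W => (e ∈ W ∧ a ∈ W) ∧ rk N (insert a' W) = 5)).card ≤
      ((biIndepSets N 6).filter (fun S => (e ∉ S ∧ a ∈ S) ∧ rk N (insert a' S) = 6)).card := by
  have ha' : a' ∈ gr N := h.2.1
  -- the demands split by `p ∈ cl W`
  have hD := card_filter_add_card_filter_not
    (s := (biIndepSets N 5).filter (fun W => (e ∈ W ∧ a ∈ W) ∧ rk N (insert a' W) = 5))
    (fun W => rk N (insert p W) = 5)
  simp only [filter_filter] at hD
  -- the units split by `a' ∈ S`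
  have hU := card_filter_add_card_filter_not
    (s := (biIndepSets N 6).filter (fun S => (e ∉ S ∧ a ∈ S) ∧ rk N (insert a' S) = 6)) (fun S => a' ∈ S)
  simp only [filter_filter] at hU
  have e1 : ((biIndepSets N 6).filter (fun S => ((e ∉ S ∧ a ∈ S) ∧ rk N (insert a' S) = 6) ∧ a' ∈ S)).card =
      ((biIndepSets N 6).filter (fun S => (e ∉ S ∧ a ∈ S) ∧ a' ∈ S)).card := by
    apply congrArg Finset.card
    apply filter_congr
    intro S hS
    constructor
    · rintro ⟨⟨hp', _⟩, ha'S⟩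
      exact ⟨hp', ha'S⟩
    · rintro ⟨hp', ha'S⟩
      refine ⟨⟨hp', ?_⟩, ha'S⟩
      rw [insert_eq_of_mem ha'S, (mem_biIndepSets.1 hS).2.2.1, (mem_biIndepSets.1 hS).2.1]
  have e2 : ((biIndepSets N 6).filter (fun S => ((e ∉ S ∧ a ∈ S) ∧ rk N (insert a' S) = 6) ∧ ¬ a' ∈ S)).card =
      ((biIndepSets N 6).filter (fun S => ((e ∉ S ∧ a ∈ S) ∧ a' ∉ S) ∧ rk N (insert a' S) = 6)).card := by
    apply congrArg Finset.card
    apply filter_congr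
    intro S _
    constructor
    · rintro ⟨⟨hp', hrk⟩, ha'S⟩
      exact ⟨⟨hp', ha'S⟩, hrk⟩
    · rintro ⟨⟨hp', ha'S⟩, hrk⟩
      exact ⟨⟨hp', hrk⟩, ha'S⟩
  have hA := card_filter_doubly_captured_le_card_demand hn hR h he hp hea hea' hpa hpa' hep hcoc
  have hB := card_demand_le_card_unit hn h he hp hea hea' hpa hpa' hep hQ hH
  have hC := card_unit_le_card_filter_capturing hn h he hp hea hea' hpa hpa' hep hH
  have hD1 := card_filter_singly_captured_le_card_filter_both hn hR h he hp hea hea' hpa hpa' hep hcoc hH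
  omega

/-- **THE COCIRCUIT REGIME OF THE TWELVE-POINT STATEMENT**: on `#E = 12`, `ρ(E) = 7`, if `{a, a'}` is a series pair
and `{a', e, p}` a cocircuit (`ρ(E − {a', e, p}) = 6` with `ρ(E − {a', e}) = ρ(E − {a', p}) = ρ(E − {e, p}) = 7`),
and `e` is off the line of the pair (`ρ{a, a', e} = 3`), then `in_5(e) ≤ out_6(e)`: the capture inequality holds
in this regime, and the capture reduction closes.  (When `ρ{a, a', e} = 2` the line regime of TwelveCaptureD
applies instead.)  In the dual this is a point `e` on a 4-point line `{a, a', e, p}` through the parallel pair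
`{a, a'}` — the «pair + two points» shape of a co-rank-2 quadruple, previously settled only under the global
quad2 hypothesis (§65(i)). -/
theorem inCount_five_le_outCount_six_of_cocircuit (hn : (gr N).card = 12) (hR : rk N (gr N) = 7) {a a' e p : α}
    (h : SeriesPair N a a') (he : e ∈ gr N) (hp : p ∈ gr N) (hea : e ≠ a) (hea' : e ≠ a') (hpa : p ≠ a)
    (hpa' : p ≠ a') (hep : e ≠ p) (hcoc : rk N ((((gr N).erase a').erase e).erase p) = 6)
    (hc1 : rk N (((gr N).erase a').erase e) = 7) (hc2 : rk N (((gr N).erase a').erase p) = 7)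
    (hc3 : rk N (((gr N).erase e).erase p) = 7) (hQ : rk N {a, a', e} = 3) :
    inCount N 5 e ≤ outCount N 6 e := by
  have ha' : a' ∈ gr N := h.2.1
  have hH : ∀ X ⊆ (((gr N).erase a').erase e).erase p,
      rk N (insert a' X) = rk N X + 1 ∧ rk N (insert e X) = rk N X + 1 ∧ rk N (insert p X) = rk N X + 1 :=
    fun X hX => rk_insert_eq_add_one_of_subset_cocircuit ha' he hp hea' hpa' hep hcoc hc1 hc2 hc3 hX
  exact inCount_five_le_outCount_six_of_seriesPair_of_capture hn hR h he hea hea'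
    (captureIneq_of_cocircuit hn hR h he hp hea hea' hpa hpa' hep hcoc hH hQ)

end TwelveCocircuitD

end PercRepro.Cogirth
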